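import Summits.HodgeConjecture.HodgeConjecture.Theorems.EightfoldBlochSeedsBlochSeedsGenericKleimanSmoothFormSuffices
import Summits.HodgeConjecture.HodgeConjecture.Theorems.EightfoldBlochSeedsBlochSeedsGenericPad4SeedMinimalClauses
import HarnessLib

/-!
# Route `EightfoldBlochSeeds`, cruxes `BlochSeedsGeneric` / `BlochSeedDiscThree` (items stmt-HodgeConjecture-18880 / 18882),
# stubs `stub_pad4_carrier` / `stub_rung_pad4_seedAt`: the SMOOTH CARRIER / SEED DOORS — `HasLciCarrierAt` and `HasBlochSeedAt`
# from a SMOOTH CONNECTED closed subscheme of the right dimension, with NO local-complete-intersection bookkeeping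

HONEST FRAMING. `--supports` helpers (doors for seed designers); nothing here proves a stub, (K), the crux, H2, HC_AV or HC. No
definition, no named fact (D-0026).

WHAT. The predicates `HasLciCarrierAt n P h w` (`EightfoldBlochSeedsDefs` §3) and `HasBlochSeedAt n P h w` ask for a closed
subscheme `i : Z ↪ P` that is a REGULAR IMMERSION OF CODIMENSION `n`, INTEGRAL, with every point of codimension `≥ n`, carrying
`q·hⁿ + w` (and Bloch-semiregular for the seed). Every design on the table (Kleiman degeneracy loci, zero loci of sections, Schoen /
Prym constructions) delivers `Z` SMOOTH and CONNECTED of dimension `dim P − n`. By this hand's K5 chain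
(`isRegularImmersionOfCodim_of_smoothOfRelativeDimension`, EGA IV 17.12.1), smooth + connected of relative dimension `dim P − n`
already gives: regular immersion of codimension `n`, integral (`isIntegral_of_smooth_of_connectedSpace`), and the codimension
clause (`coheight_ge_of_isRegularImmersionOfCodim`). Hence:

* `hasLciCarrierAt_of_smoothOfRelativeDimension` — a closed `i : Z ↪ P` with `Z` connected and smooth of relative dimension `m` over `ℂ`,
  `m + n = dim P`, carrying `q·hⁿ + w` ⟹ `HasLciCarrierAt n P h w`;
* `hasBlochSeedAt_of_smoothOfRelativeDimension` — the same plus `IsBlochSemiregular i (2n) n` ⟹ `HasBlochSeedAt n P h w`.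

So for the carrier / rung stubs a designer supplies ONLY: smoothness of relative dimension `4`, connectedness, the supported class
(and semiregularity for the rung) — compare 1-g0's `hasBlochSeedAt_of_smooth_connected` (`…Pad4SeedMinimalClauses`), which still
takes `IsRegularImmersionOfCodim i n` as a hypothesis. [cite: EGAIV4, Prop. 17.12.1] [cite: Bloch1972Semiregularity, Remark (7.5)]
[cite: Fulton1998, Example 15.3.2 and App. B.3.4]
-/

noncomputable section

-- single-problem summit (Problem = Summit): the mandated namespace repeats `HodgeConjecture`.
set_option linter.dupNamespace false

open CategoryTheory AlgebraicGeometry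
open Literature.AlgebraicGeometry Literature.AlgebraicGeometry.Motives Literature.AlgebraicGeometry.HodgeTheory
open Literature.AlgebraicTopology.SingularHomology
open Summit.HodgeConjecture.HodgeConjecture.Theorems.EightfoldBlochSeeds

namespace Summit.HodgeConjecture.HodgeConjecture.Theorems

variable {P : AbelianVariety ℂ} {n m : ℕ}

/-- **The smooth carrier door**: on a complex abelian variety `P`, a closed subscheme `i : Z ↪ P` with `Z` connected and smooth
of relative dimension `m` over `ℂ`, `m + n = dim P`, on which `q·hⁿ + w` is supported, gives `HasLciCarrierAt n P h w` — the
regular-immersion, integrality and codimension clauses are automatic (`isRegularImmersionOfCodim_of_smoothOfRelativeDimension`,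
`isIntegral_of_smooth_of_connectedSpace`, `coheight_ge_of_isRegularImmersionOfCodim`).
[cite: EGAIV4, Prop. 17.12.1] [cite: Fulton1998, Example 15.3.2] -/
theorem hasLciCarrierAt_of_smoothOfRelativeDimension (h : complexBetti P.X 2) (w : complexBetti P.X (2 * n)) {Z : Scheme.{0}}
    (i : Z ⟶ P.X.left) [IsClosedImmersion i] [SmoothOfRelativeDimension m (i ≫ P.X.hom)] [ConnectedSpace Z]
    (hmn : m + n = P.dim) (q : ℚ)
    (hsupp : ((q : ℚ) : ℂ) • cupPowTwo h n + w ∈ classesSupportedOn P.X (Set.range i.base) (2 * n)) :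
    HasLciCarrierAt n P h w := by
  have hP := AbelianVariety.isSmoothProjective_holds (A := P)
  haveI : IrreducibleSpace P.X.left := hP.irreducibleSpace
  haveI : SmoothOfRelativeDimension P.dim P.X.hom := hP.smoothOfRelativeDimension
  haveI : Smooth (i ≫ P.X.hom) := SmoothOfRelativeDimension.smooth m (i ≫ P.X.hom)
  haveI : AlgebraicGeometry.IsIntegral Z := isIntegral_of_smooth_of_connectedSpace (i ≫ P.X.hom)
  have hreg : IsRegularImmersionOfCodim i n := isRegularImmersionOfCodim_of_smoothOfRelativeDimension P.X.hom i hmn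
  exact ⟨Z, i, q, inferInstance, hreg, inferInstance, coheight_ge_of_isRegularImmersionOfCodim hreg, hsupp⟩

/-- **The smooth seed door**: as `hasLciCarrierAt_of_smoothOfRelativeDimension`, plus Bloch semiregularity `IsBlochSemiregular i (2n) n` of
the same `i`, gives `HasBlochSeedAt n P h w` (Bloch 1972, Remark (7.5): «a subscheme which is semi-regular and a local complete
intersection» — the l.c.i. clause is free for smooth `Z`). [cite: Bloch1972Semiregularity, Thm. (7.4) and Remark (7.5)]
[cite: EGAIV4, Prop. 17.12.1] -/
theorem hasBlochSeedAt_of_smoothOfRelativeDimension (h : complexBetti P.X 2) (w : complexBetti P.X (2 * n)) {Z : Scheme.{0}}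
    (i : Z ⟶ P.X.left) [IsClosedImmersion i] [SmoothOfRelativeDimension m (i ≫ P.X.hom)] [ConnectedSpace Z]
    (hmn : m + n = P.dim) (q : ℚ) (hsr : IsBlochSemiregular i (2 * n) n)
    (hsupp : ((q : ℚ) : ℂ) • cupPowTwo h n + w ∈ classesSupportedOn P.X (Set.range i.base) (2 * n)) :
    HasBlochSeedAt n P h w := by
  have hP := AbelianVariety.isSmoothProjective_holds (A := P)
  haveI : IrreducibleSpace P.X.left := hP.irreducibleSpace
  haveI : SmoothOfRelativeDimension P.dim P.X.hom := hP.smoothOfRelativeDimension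
  haveI : Smooth (i ≫ P.X.hom) := SmoothOfRelativeDimension.smooth m (i ≫ P.X.hom)
  haveI : AlgebraicGeometry.IsIntegral Z := isIntegral_of_smooth_of_connectedSpace (i ≫ P.X.hom)
  have hreg : IsRegularImmersionOfCodim i n := isRegularImmersionOfCodim_of_smoothOfRelativeDimension P.X.hom i hmn
  exact ⟨Z, i, q, inferInstance, hreg, inferInstance, coheight_ge_of_isRegularImmersionOfCodim hreg, hsr, hsupp⟩

end Summit.HodgeConjecture.HodgeConjecture.Theorems

end
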